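import Mathlib.Analysis.SpecialFunctions.Pow.Asymptotics
import Mathlib.Logic.Equiv.Fin.Basic
import Mathlib.Combinatorics.SimpleGraph.Star
import Literature.Computability.FineGrained.Conjectures
import Literature.Computability.Cryptography.WordRAMWrites
import Literature.Computability.Cryptography.GraphPathProblemsProofs
import Literature.Computability.Cryptography.APSPWordRAM
import HarnessLib

/-!
# The APSP conjecture: status, and the trivial regime `ε > 1` (proved)

Companion to `Literature.Computability.FineGrained.Conjectures` (fine-grained.S11, the APSP
hypothesis); the 3SUM companion is `…FineGrained.ConjecturesProofs`. Kept in its own file because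
of its heavier imports (the verified Floyd–Warshall file `…Cryptography.APSPWordRAM` for the
input-format lemmas, Mathlib's star graphs and real powers).

`Literature.Computability.FineGrained.APSPConjecture` (fine-grained.S11) vendors the **APSP
hypothesis** of V. Vassilevska Williams and R. Williams, *Subcubic equivalences between path,
matrix, and triangle problems*, J. ACM 65 (2018), §1: for every `ε > 0`, for large enough `c`,
APSP on `n`-node graphs with weights in `{-n^c, …, n^c}` has no `O(n^{3-ε})`-time (word-RAM)
algorithm. The source poses the cubic hardness of APSP as an OPEN QUESTION (p. 27:2: "One of the
'Holy Grails' of graph algorithms is to determine whether this cubic complexity is basically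
inherent"; p. 27:1: "if APSP cannot be solved in `n^{3-ε}` time for any `ε > 0`, then …") and
proves only *equivalences* (Thm. 1.1); it contains no theorem asserting the hypothesis, and none
is known: for `0 < ε ≤ 1` a proof would be a superlinear time lower bound (in the input length
`N = n² + 1`: time `N^{(3-ε)/2}`) for an explicit polynomial-time function on the unit-cost word
RAM, and a refutation would be a truly subcubic APSP algorithm. Accordingly `APSPConjecture`
stays a named hypothesis (`def … : Prop`, docstring "(open; …)"); there is no
`APSPConjecture_holds`.

What this file proves is the part of the hypothesis that IS a theorem, the **output-size regime
`ε > 1`** (time `o(n²)`), uniformly in the weight exponent `c`: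

* `starWeights m` (unit weights on Mathlib's star `SimpleGraph.starGraph 0` on `Fin (m+1)`, `⊤`
  off its edges): an `APSP c` instance of size `n = m + 1` for every `c`
  (`hasBoundedWeights_starWeights`, `hasNoNegativeCycle_starWeights`) all of whose `n²` distances
  are finite (`shortestDist_starWeights_ne_top`) while the `m²` input words of the off-centre
  entries are the code `0` of `⊤`; hence every correct program changes at least `m²` memory
  cells on it (`mem_offCentreCell_ne`), so runs for at least `m²` steps
  (`mul_self_le_of_haltsWithin_star`, by the write-counting lemma
  `WordRAM.HaltsWithin.card_le_of_mem_ne` of `…Cryptography.WordRAMWrites`);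
* `APSP_not_inTimeO_rpow_of_lt_two`: for every `c` and every real `s < 2`, `APSP c` is not
  solvable in time `O(n^s)` (the budget `⌊C n^s + C⌋₊` is eventually below `m²`,
  `exists_floor_lt_mul_self`); equivalently (`APSP_not_inTimeO_of_one_lt`,
  `apspConjecture_restricted_one_lt`) the `ε > 1` instances of `APSPConjectureFor c` /
  `APSPConjecture` hold outright, so that both hypotheses are equivalent to their restrictions
  to `0 < ε ≤ 1` (`apspConjectureFor_iff_le_one`, `apspConjecture_iff_le_one`);
* `apspConjectureFor_iff_not_trulySubTime`, `apspConjecture_of_not_trulySubTime`: the link with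
  the `TrulySubTime` vocabulary of the subcubic equivalences (fine-grained.S12).

The regime `0 < ε ≤ 1` — the actual content of the APSP hypothesis — is untouched and open.

## References

* V. Vassilevska Williams, R. R. Williams, *Subcubic equivalences between path, matrix, and
  triangle problems*, J. ACM 65 (2018), no. 5, Art. 27, §1, pp. 27:1–27:5 (the hypothesis,
  stated conditionally; Thm. 1.1). doi:10.1145/3186893
  [cite: VassilevskaWilliamsWilliams2018, §1]
* V. Vassilevska Williams, *On some fine-grained questions in algorithms and complexity*,
  Proc. ICM 2018, §4, Hypothesis 4 (the APSP hypothesis, "for large enough `c`").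
* Output-size lower bounds (`Ω(output length)` steps for a machine writing one word per step):
  folklore.
-/

namespace Literature.Computability.FineGrained

open Filter Cryptography Cryptography.WordRAM

/-! ## The hard instances of the trivial regime: unit-weight stars -/

/-- The weight matrix of the star `K_{1,m}` on `Fin (m + 1)` centred at vertex `0` (Mathlib's
`SimpleGraph.starGraph 0`): weight `1` on its edges, `⊤` (no edge) elsewhere. [folklore] -/
def starWeights (m : ℕ) : Matrix (Fin (m + 1)) (Fin (m + 1)) (WithTop ℤ) :=
  zeroOneWeights (SimpleGraph.starGraph (0 : Fin (m + 1)))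

/-- Off the centre the star has no edges: `starWeights m i j = ⊤` when `i, j ≠ 0`. [folklore] -/
theorem starWeights_of_ne_zero {m : ℕ} {i j : Fin (m + 1)} (hi : i ≠ 0) (hj : j ≠ 0) :
    starWeights m i j = ⊤ := by
  have h : ¬ (SimpleGraph.starGraph (0 : Fin (m + 1))).Adj i j := fun h => by
    rw [SimpleGraph.starGraph_adj] at h
    exact h.2.elim hi hj
  simp only [starWeights, zeroOneWeights_apply, if_neg h]

/-- The star's weights lie in `[-(m+1)^c, (m+1)^c]` for every `c` (they are `1`). [folklore] -/
theorem hasBoundedWeights_starWeights (m c : ℕ) :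
    HasBoundedWeights (starWeights m) ((m + 1) ^ c) := by
  intro i j
  by_cases h : (SimpleGraph.starGraph (0 : Fin (m + 1))).Adj i j
  · refine Or.inr ⟨1, ?_, ?_⟩
    · simp only [starWeights, zeroOneWeights_apply, if_pos h, WithTop.coe_one]
    · rw [abs_one]
      exact_mod_cast Nat.one_le_pow c (m + 1) (Nat.succ_pos m)
  · exact Or.inl (by simp only [starWeights, zeroOneWeights_apply, if_neg h])

/-- The star has no negative cycle (unit weights). [folklore] -/
theorem hasNoNegativeCycle_starWeights (m : ℕ) : HasNoNegativeCycle (starWeights m) :=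
  hasNoNegativeCycle_zeroOneWeights_holds (SimpleGraph.starGraph (0 : Fin (m + 1)))

/-- All `(m+1)²` distances in the star are finite (it is connected,
`SimpleGraph.connected_starGraph`). [folklore] -/
theorem shortestDist_starWeights_ne_top {m : ℕ} (i j : Fin (m + 1)) :
    shortestDist (starWeights m) i j ≠ ⊤ := by
  unfold starWeights
  rw [shortestDist_zeroOneWeights_holds (SimpleGraph.starGraph (0 : Fin (m + 1))) i j]
  obtain ⟨d, hd⟩ := WithTop.ne_top_iff_exists.1 (SimpleGraph.edist_ne_top_iff_reachable.2
    ((SimpleGraph.connected_starGraph (0 : Fin (m + 1))).preconnected i j))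
  rw [← hd]
  exact WithTop.coe_ne_top

/-- The star on `m + 1` vertices, as an instance of `APSP c` (size `m + 1`). [folklore] -/
def starInst (c m : ℕ) : (APSP c).Inst :=
  ⟨⟨m + 1, starWeights m⟩, hasBoundedWeights_starWeights m c,
    hasNoNegativeCycle_starWeights m⟩

/-- Codes of finite weights are nonzero (`⊤ ↦ 0`, `z ↦ encodeInt z + 1`). [folklore] -/
theorem encodeWithTopInt_ne_zero_of_ne_top {d : WithTop ℤ} (hd : d ≠ ⊤) :
    encodeWithTopInt d ≠ 0 := by
  obtain ⟨z, rfl⟩ := WithTop.ne_top_iff_exists.1 hd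
  exact Nat.succ_ne_zero _

/-- The memory cell holding entry `(a+1, b+1)` of an `(m+1) × (m+1)` matrix in the APSP
input/output format (cell `i (m+1) + j + 2` for entry `(i, j)`). [folklore] -/
def offCentreCell (m : ℕ) (p : Fin m × Fin m) : ℕ :=
  (finProdFinEquiv (p.1.succ, p.2.succ) : ℕ) + 2

/-- `offCentreCell` is injective. [folklore] -/
theorem offCentreCell_injective (m : ℕ) : Function.Injective (offCentreCell m) := by
  intro p q h
  have h' : finProdFinEquiv (p.1.succ, p.2.succ) = finProdFinEquiv (q.1.succ, q.2.succ) :=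
    Fin.ext (by unfold offCentreCell at h; omega)
  have h'' := finProdFinEquiv.injective h'
  simp only [Prod.mk.injEq, Fin.succ_inj] at h''
  exact Prod.ext h''.1 h''.2

/-- The address formula: `offCentreCell m (a, b) = (a+1)(m+1) + (b+1) + 2`. [folklore] -/
theorem offCentreCell_eq (m : ℕ) (p : Fin m × Fin m) :
    offCentreCell m p = (p.1.succ : ℕ) * (m + 1) + (p.2.succ : ℕ) + 1 + 1 := by
  unfold offCentreCell
  rw [finProdFinEquiv_apply_val]
  ring

/-- **Every correct APSP program changes the `m²` off-centre cells on the star with `m + 1`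
vertices**: such a cell holds the code `0` of `⊤` initially (whatever the word size) and a
nonzero code (a finite distance) in any configuration whose output is the distance matrix.
[folklore] -/
theorem mem_offCentreCell_ne {c m w : ℕ} {cfg : Cfg}
    (hout : readOut cfg.mem = encodeMatrixWithTop (shortestDist (starWeights m)))
    (p : Fin m × Fin m) :
    cfg.mem (offCentreCell m p) ≠
      (init w ((APSP c).encode (starInst c m))).mem (offCentreCell m p) := by
  rw [offCentreCell_eq]
  set i : Fin (m + 1) := p.1.succ with hi
  set j : Fin (m + 1) := p.2.succ with hj
  have hi0 : i ≠ 0 := Fin.succ_ne_zero _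
  have hj0 : j ≠ 0 := Fin.succ_ne_zero _
  -- the input word at index `i (m+1) + j + 1` is the code `0` of `⊤`
  have hx : ((APSP c).encode (starInst c m))[(i : ℕ) * (m + 1) + j + 1]? = some 0 := by
    change (encodeMatrixWithTop (starWeights m))[(i : ℕ) * (m + 1) + j + 1]? = some 0
    rw [APSPProg.encodeMatrixWithTop_getElem? (starWeights m) i j,
      starWeights_of_ne_zero hi0 hj0]
    rfl
  have hlt : (i : ℕ) * (m + 1) + j + 1 < ((APSP c).encode (starInst c m)).length := by
    rcases lt_or_ge ((i : ℕ) * (m + 1) + j + 1) ((APSP c).encode (starInst c m)).length with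
      hl | hl
    · exact hl
    · rw [List.getElem?_eq_none_iff.2 hl] at hx; exact absurd hx (by simp)
  have hinit : (init w ((APSP c).encode (starInst c m))).mem ((i : ℕ) * (m + 1) + j + 1 + 1)
      = 0 := by
    rw [init_mem_succ _ _ _ hlt]
    rw [List.getElem?_eq_getElem hlt, Option.some.injEq] at hx
    rw [hx, Nat.zero_mod]
  -- the output word at the same index is the (nonzero) code of a finite distance
  have hy : (encodeMatrixWithTop (shortestDist (starWeights m)))[(i : ℕ) * (m + 1) + j + 1]?
      = some (encodeWithTopInt (shortestDist (starWeights m) i j)) :=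
    APSPProg.encodeMatrixWithTop_getElem? _ i j
  have hlt' : (i : ℕ) * (m + 1) + j + 1 < (readOut cfg.mem).length := by
    rw [hout]
    rcases lt_or_ge ((i : ℕ) * (m + 1) + j + 1)
        (encodeMatrixWithTop (shortestDist (starWeights m))).length with hl | hl
    · exact hl
    · rw [List.getElem?_eq_none_iff.2 hl] at hy; exact absurd hy (by simp)
  have hfin : cfg.mem (1 + ((i : ℕ) * (m + 1) + j + 1)) ≠ 0 := by
    rw [← getElem_readOut cfg.mem hlt']
    have hy' := hy
    rw [← hout] at hy'
    rw [List.getElem?_eq_getElem hlt', Option.some.injEq] at hy'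
    rw [hy']
    exact encodeWithTopInt_ne_zero_of_ne_top (shortestDist_starWeights_ne_top i j)
  rw [show 1 + ((i : ℕ) * (m + 1) + j + 1) = (i : ℕ) * (m + 1) + j + 1 + 1 by ring] at hfin
  rw [hinit]
  exact hfin

/-- **Hence every correct run on the star takes at least `m²` steps** (write counting,
`WordRAM.HaltsWithin.card_le_of_mem_ne`). [folklore] -/
theorem mul_self_le_of_haltsWithin_star {c m w t : ℕ} {M : Program} {ρ : ℕ → ℕ} {cfg : Cfg}
    (hhalt : HaltsWithin M w noOracle ρ ((APSP c).encode (starInst c m)) t cfg)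
    (hout : readOut cfg.mem = encodeMatrixWithTop (shortestDist (starWeights m))) :
    m * m ≤ t := by
  classical
  calc m * m = (Finset.univ.image (offCentreCell m)).card := by
        rw [Finset.card_image_of_injective _ (offCentreCell_injective m), Finset.card_univ,
          Fintype.card_prod, Fintype.card_fin]
    _ ≤ t := hhalt.card_le_of_mem_ne fun b hb => by
        obtain ⟨p, -, rfl⟩ := Finset.mem_image.1 hb
        exact mem_offCentreCell_ne hout p

/-! ## The analytic step: `C (m+1)^s + C < m²` eventually, for `s < 2` -/

/-- For `s < 2` and any constant `C`, the time budget `⌊C (m+1)^s + C⌋₊` on `m + 1` vertices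
is eventually below the `m²` forced cell changes. [folklore] -/
theorem exists_floor_lt_mul_self (C : ℝ) {s : ℝ} (hs : s < 2) :
    ∃ m : ℕ, ⌊C * ((m + 1 : ℕ) : ℝ) ^ s + C⌋₊ < m * m := by
  set C' : ℝ := max C 1 with hC'
  have hC'pos : 0 < C' := lt_of_lt_of_le one_pos (le_max_right _ _)
  have hCC' : C ≤ C' := le_max_left _ _
  have h1 : ∀ᶠ N : ℕ in atTop, 8 * C' < (N : ℝ) ^ (2 - s) :=
    ((tendsto_rpow_atTop (by linarith : 0 < 2 - s)).comp
      tendsto_natCast_atTop_atTop).eventually_gt_atTop _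
  have h2 : ∀ᶠ N : ℕ in atTop, 8 * C' < (N : ℝ) ^ (2 : ℕ) :=
    ((tendsto_pow_atTop two_ne_zero).comp tendsto_natCast_atTop_atTop).eventually_gt_atTop _
  obtain ⟨N, hN1, hN2, hN3⟩ := (h1.and (h2.and (eventually_ge_atTop 2))).exists
  refine ⟨N - 1, ?_⟩
  have hN0 : (0 : ℝ) < N := by exact_mod_cast (by omega : 0 < N)
  have hN2' : (2 : ℝ) ≤ N := by exact_mod_cast hN3
  have hsub : ((N - 1 : ℕ) : ℝ) = N - 1 := by rw [Nat.cast_sub (by omega), Nat.cast_one]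
  rw [show N - 1 + 1 = N by omega, Nat.floor_lt' (Nat.mul_pos (by omega) (by omega)).ne',
    Nat.cast_mul, hsub]
  have hpos : 0 < (N : ℝ) ^ s := Real.rpow_pos_of_pos hN0 s
  have hsplit : (N : ℝ) ^ s * (N : ℝ) ^ (2 - s) = (N : ℝ) ^ (2 : ℕ) := by
    rw [← Real.rpow_add hN0, show s + (2 - s) = (2 : ℝ) by ring, Real.rpow_two]
  have hA : C * (N : ℝ) ^ s < (N : ℝ) ^ (2 : ℕ) / 8 := by
    have h8 : 8 * C' * (N : ℝ) ^ s < (N : ℝ) ^ (2 : ℕ) := by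
      rw [← hsplit]; nlinarith [hN1, hpos]
    nlinarith [hCC', hpos, h8]
  have hB : C < (N : ℝ) ^ (2 : ℕ) / 8 := by linarith
  have hC : (N : ℝ) ^ (2 : ℕ) / 4 ≤ (N - 1) * (N - 1) := by nlinarith [hN2']
  linarith

/-! ## The trivial regime of the APSP hypothesis -/

/-- **APSP needs `Ω(n²)` time (output size).** For every weight exponent `c` and every real
`s < 2`, `APSP c` has no deterministic word-RAM algorithm running in time `O(n^s)`: on the
unit-weight star with `n = m + 1` vertices any correct program runs for at least `m²` steps
(`mul_self_le_of_haltsWithin_star`), while its budget `⌊C n^s + C⌋₊` is eventually smaller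
(`exists_floor_lt_mul_self`). [folklore] -/
theorem APSP_not_inTimeO_rpow_of_lt_two (c : ℕ) {s : ℝ} (hs : s < 2) :
    ¬ (APSP c).InTimeO fun n => (n : ℝ) ^ s := by
  rintro ⟨C, M, k, -, -, hM⟩
  obtain ⟨m, hm⟩ := exists_floor_lt_mul_self C hs
  obtain ⟨out, hout, hrun⟩ := hM (starInst c m)
  have hout' : out = encodeMatrixWithTop (shortestDist (starWeights m)) := by
    simpa [starInst] using hout
  subst hout'
  rw [outputsWithin_iff_exists_haltsWithin] at hrun
  obtain ⟨cfg, hhalt, hro⟩ := hrun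
  have hle := mul_self_le_of_haltsWithin_star hhalt hro
  change m * m ≤ ⌊C * ((m + 1 : ℕ) : ℝ) ^ s + C⌋₊ at hle
  exact absurd (lt_of_le_of_lt hle hm) (lt_irrefl _)

/-- **The `ε > 1` instances of the APSP hypothesis hold, for every weight exponent.** For `ε > 1`
there is no `O(n^{3-ε})`-time algorithm for `APSP c`, whatever `c` (output size). The instances
`0 < ε ≤ 1` of `APSPConjectureFor c` / `APSPConjecture` are the open APSP hypothesis of
Vassilevska Williams–Williams, J. ACM 65 (2018), §1, and are not asserted anywhere in this
library. [folklore] -/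
theorem APSP_not_inTimeO_of_one_lt (c : ℕ) {ε : ℝ} (hε : 1 < ε) :
    ¬ (APSP c).InTimeO fun n => (n : ℝ) ^ (3 - ε) :=
  APSP_not_inTimeO_rpow_of_lt_two c (by linarith)

/-- The APSP hypothesis restricted to `ε > 1` holds (with `c = 0` as witness for every such
`ε`); the full statement `APSPConjecture` (all `ε > 0`) is open. [folklore] -/
theorem apspConjecture_restricted_one_lt :
    ∀ ε : ℝ, 1 < ε → ∃ c : ℕ, ¬ (APSP c).InTimeO fun n => (n : ℝ) ^ (3 - ε) :=
  fun _ hε => ⟨0, APSP_not_inTimeO_of_one_lt 0 hε⟩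

/-- **What remains open is exactly the regime `0 < ε ≤ 1`:** `APSPConjectureFor c` is
equivalent to its restriction to `0 < ε ≤ 1` (the instances `ε > 1` being theorems).
[folklore] -/
theorem apspConjectureFor_iff_le_one (c : ℕ) :
    APSPConjectureFor c ↔
      ∀ ε : ℝ, 0 < ε → ε ≤ 1 → ¬ (APSP c).InTimeO fun n => (n : ℝ) ^ (3 - ε) := by
  refine ⟨fun h ε hε _ => h ε hε, fun h ε hε => ?_⟩
  rcases le_or_gt ε 1 with hle | hlt
  · exact h ε hε hle
  · exact APSP_not_inTimeO_of_one_lt c hlt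

/-- Likewise `APSPConjecture` (VW–W, J. ACM 65 (2018), §1; VVW ICM 2018, §4, Hypothesis 4) is
equivalent to its restriction to `0 < ε ≤ 1`. [folklore] -/
theorem apspConjecture_iff_le_one :
    APSPConjecture ↔
      ∀ ε : ℝ, 0 < ε → ε ≤ 1 →
        ∃ c : ℕ, ¬ (APSP c).InTimeO fun n => (n : ℝ) ^ (3 - ε) := by
  refine ⟨fun h ε hε _ => h ε hε, fun h ε hε => ?_⟩
  rcases le_or_gt ε 1 with hle | hlt
  · exact h ε hε hle
  · exact apspConjecture_restricted_one_lt ε hlt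

/-! ## Link with the `TrulySubTime` vocabulary of the subcubic equivalences (fine-grained.S12) -/

/-- `APSPConjectureFor c` says exactly that `APSP c` is not truly subcubic
(`FGProblem.TrulySubTime`, VVW ICM 2018, §2: time `O(n^{3-ε})` for some `ε > 0`), the
vocabulary of VW–W's Thm. 1.1 ("either all of them have truly subcubic algorithms, or none of
them do"). [folklore] -/
theorem apspConjectureFor_iff_not_trulySubTime (c : ℕ) :
    APSPConjectureFor c ↔ ¬ (APSP c).TrulySubTime 3 :=
  ⟨fun h ⟨ε, hε, hT⟩ => h ε hε hT, fun h ε hε hT => h ⟨ε, hε, hT⟩⟩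

/-- Hence the APSP hypothesis follows as soon as one weight exponent `c` makes `APSP c` not
truly subcubic (and then every `c' ≥ c` does, `APSPConjectureFor.mono`). [folklore] -/
theorem apspConjecture_of_not_trulySubTime {c : ℕ} (h : ¬ (APSP c).TrulySubTime 3) :
    APSPConjecture :=
  apspConjecture_of_apspConjectureFor ((apspConjectureFor_iff_not_trulySubTime c).2 h)

end Literature.Computability.FineGrained
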